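import Literature.NumberTheory.Sieve.DrappeauDispersionMainKernel
import Mathlib.NumberTheory.ArithmeticFunction.Liouville
import Literature.NumberTheory.Sieve.FouvryTenenbaumLiouvilleProofs
import HarnessLib

/-!
# Drappeau's small-conductor kernel against the Liouville function in a residue class

Topic `Literature/NumberTheory/Sieve`; theorems only, everything PROVED.  Continuation of
`DrappeauDispersionMainKernel.lean`: the main terms of the dispersion method in Drappeau's
conductor-truncated form (Proc. London Math. Soc. (3) 114 (2017), §5 (5.1), §6 `𝒮₁⁻`) for the Liouville function
summed over ONE residue class `m ≡ e (mod L)` and averaged over a finite set `𝒮` of smooth moduli `s`,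

`I = ∑_{s ∈ 𝒮} ∑_{m ≤ N, m ≡ e (L)} λ(m) K_R(m c̄; s)`,  `K_R(t; s) = φ(s)⁻¹ ∑_{χ mod s, cond χ ≤ R} χ(t)`,

are reduced to twisted Liouville sums over the classes `d t ≡ e (mod L)` against PRIMITIVE characters:

* `norm_sum_class_liouville_mainKernel_le` —
  `‖I‖ ≤ ∑_{(f,ψ*), f ≤ R} ∑_{d ≤ S} ω(f, d) · ‖∑_{t ≤ N/d, dt ≡ e (L)} λ(t) ψ*(t)‖`,
  `ω(f, d) = ∑_{s ∈ 𝒮, f ∣ s, d ∣ s} φ(s)⁻¹`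
  (kernel → characters → primitive characters, Möbius over `d ∣ (m, s)`, `m = dt` and the complete
  multiplicativity of `λ` and `ψ*`, then the swap of the `s`-average; no coprimality hypothesis is needed);
* the trivial bound for one class, `norm_sum_filter_mul_char_le_card` / `card_filter_mul_natCast_eq_le`
  (`‖∑_{t ≤ M, dt ≡ e (L)} λ(t)ψ(t)‖ ≤ M/L + 1` when `(d, L) = 1`).

Consumer: stub `stub_mainTerms` of the crux `TypeI2Dilated` (line `peel-to-drappeau`,
`Summits/Parity/GeneralizedHardyLittlewood/Theses/LiouvilleShiftedTables.lean`).

## References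

* S. Drappeau, Proc. London Math. Soc. (3) 114 (2017) 684–732 = arXiv:1504.05549, §5 (5.1), §6. [Drappeau2017]
-/

noncomputable section

open Finset Real Complex

namespace Literature.NumberTheory.Sieve

namespace Drappeau2017

open VaughanMoebius BVMoebius ArithmeticFunction
open scoped ArithmeticFunction.Moebius Classical

/-! ### Small lemmas on `λ` and characters -/

/-- `‖λ(n)‖ ≤ 1` (as a complex number). [folklore] -/
theorem norm_liouville_le_one (n : ℕ) : ‖((liouville n : ℤ) : ℂ)‖ ≤ 1 := by
  rw [Complex.norm_intCast]
  rcases eq_or_ne n 0 with rfl | hn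
  · simp
  · rw [liouville_apply hn]
    rcases neg_one_pow_eq_or ℤ (cardFactors n) with h | h <;> rw [h] <;> simp

/-- `λ(dt) ψ(dt) = (λ(d) ψ(d)) · (λ(t) ψ(t))` for a Dirichlet character `ψ`. [folklore] -/
theorem liouville_char_mul {f : ℕ} (ψ : DirichletCharacter ℂ f) (d t : ℕ) :
    ((liouville (d * t) : ℤ) : ℂ) * ψ ((d * t : ℕ) : ZMod f) =
      (((liouville d : ℤ) : ℂ) * ψ (d : ZMod f)) * (((liouville t : ℤ) : ℂ) * ψ (t : ZMod f)) := by
  rw [liouville_apply_mul, Int.cast_mul, Nat.cast_mul, map_mul]; ring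

/-- `‖λ(d) ψ(d)‖ ≤ 1`. [folklore] -/
theorem norm_liouville_mul_char_le {f : ℕ} (ψ : DirichletCharacter ℂ f) (d : ℕ) :
    ‖((liouville d : ℤ) : ℂ) * ψ (d : ZMod f)‖ ≤ 1 := by
  rw [norm_mul]
  exact mul_le_one₀ (norm_liouville_le_one d) (norm_nonneg _) (ψ.norm_le_one _)

/-! ### One modulus `s`: kernel → primitive characters → Möbius -/

/-- For one smooth modulus `s ≥ 1`:
`‖∑_{m ≤ N, m ≡ e (L)} λ(m) K_R(m c̄; s)‖ ≤ φ(s)⁻¹ ∑_{(f,ψ*) ∈ S(s), f ≤ R} ∑_{d ∣ s} ‖∑_{t ≤ N/d, dt ≡ e (L)} λ(t)ψ*(t)‖`.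
[cite: Drappeau2017, §5 (5.1)] -/
theorem norm_class_liouville_mainKernel_le_one {s : ℕ} (hs : 0 < s) (c : ZMod s) {L : ℕ} (e : ZMod L)
    (R : ℝ) (N : ℕ) :
    ‖∑ m ∈ (Icc 1 N).filter (fun m : ℕ => (m : ZMod L) = e),
        ((liouville m : ℤ) : ℂ) * mainKernel R s ((m : ZMod s) * c⁻¹)‖ ≤
      ((Nat.totient s : ℝ))⁻¹ *
        ∑ p ∈ (primIndex s).filter (fun p => ((p.1 : ℕ) : ℝ) ≤ R), ∑ d ∈ s.divisors,
          ‖∑ t ∈ (Icc 1 (N / d)).filter (fun t : ℕ => ((d * t : ℕ) : ZMod L) = e),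
              ((liouville t : ℤ) : ℂ) * p.2 (t : ZMod p.1)‖ := by
  have hφ : (0 : ℝ) ≤ ((Nat.totient s : ℝ))⁻¹ := inv_nonneg.2 (Nat.cast_nonneg _)
  refine (norm_sum_mul_mainKernel_le hs R c (fun m => ((liouville m : ℤ) : ℂ)) _).trans ?_
  refine mul_le_mul_of_nonneg_left (sum_le_sum fun p _ => ?_) hφ
  -- the weights `a(m) = λ(m) 1_{m ≡ e (L)}` on `[1, N]`
  set a : ℕ → ℂ := fun m => if (m : ZMod L) = e then ((liouville m : ℤ) : ℂ) else 0 with ha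
  have hfilt : ∑ m ∈ (Icc 1 N).filter (fun m : ℕ => (m : ZMod L) = e),
      ((liouville m : ℤ) : ℂ) * copChar s p.2 m = ∑ m ∈ Icc 1 N, a m * copChar s p.2 m := by
    rw [sum_filter]
    refine sum_congr rfl fun m _ => ?_
    simp only [ha]
    split_ifs <;> simp
  rw [hfilt, sum_mul_copChar_eq_sum_divisors hs.ne' p.2 a N]
  refine (norm_sum_le _ _).trans (sum_le_sum fun d _ => ?_)
  -- `‖μ(d) ∑_t a(dt) ψ*(dt)‖ ≤ ‖∑_{t : dt ≡ e} λ(t)ψ*(t)‖`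
  have hμ : ‖((μ d : ℤ) : ℂ)‖ ≤ 1 := by
    rw [Complex.norm_intCast, ← Int.cast_abs]; exact_mod_cast abs_moebius_le_one
  have hinner : ∑ t ∈ Icc 1 (N / d), a (d * t) * p.2 ((d * t : ℕ) : ZMod p.1) =
      (((liouville d : ℤ) : ℂ) * p.2 (d : ZMod p.1)) *
        ∑ t ∈ (Icc 1 (N / d)).filter (fun t : ℕ => ((d * t : ℕ) : ZMod L) = e),
          ((liouville t : ℤ) : ℂ) * p.2 (t : ZMod p.1) := by
    rw [sum_filter, mul_sum]
    refine sum_congr rfl fun t _ => ?_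
    simp only [ha]
    split_ifs with h
    · rw [liouville_char_mul]
    · simp
  rw [norm_mul, hinner, norm_mul]
  calc ‖((μ d : ℤ) : ℂ)‖ * (‖((liouville d : ℤ) : ℂ) * p.2 (d : ZMod p.1)‖ *
        ‖∑ t ∈ (Icc 1 (N / d)).filter (fun t : ℕ => ((d * t : ℕ) : ZMod L) = e),
          ((liouville t : ℤ) : ℂ) * p.2 (t : ZMod p.1)‖)
      ≤ 1 * (1 * ‖∑ t ∈ (Icc 1 (N / d)).filter (fun t : ℕ => ((d * t : ℕ) : ZMod L) = e),
          ((liouville t : ℤ) : ℂ) * p.2 (t : ZMod p.1)‖) := by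
        gcongr
        · exact norm_liouville_mul_char_le p.2 d
    _ = _ := by ring

/-! ### The average over `s` -/

/-- **Main terms in Drappeau's form for `λ` over one class, reduced to primitive characters.**  For any
finite set `𝒮 ⊆ [1, S]` of moduli, any `c : ℤ`, class `e mod L`, conductor cut `R` and height `N`:
`‖∑_{s ∈ 𝒮} ∑_{m ≤ N, m ≡ e (L)} λ(m) K_R(m c̄; s)‖ ≤ ∑_{(f,ψ*), f ≤ R} ∑_{d ≤ S} ω(f, d) ‖∑_{t ≤ N/d, dt ≡ e (L)} λ(t)ψ*(t)‖`
with the weights `ω(f, d) = ∑_{s ∈ 𝒮, f ∣ s, d ∣ s} φ(s)⁻¹`. [cite: Drappeau2017, §6 (𝒮₁⁻)] -/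
theorem norm_sum_class_liouville_mainKernel_le (c : ℤ) {L : ℕ} (e : ZMod L) (R : ℝ) (N : ℕ)
    {𝒮 : Finset ℕ} {S : ℕ} (h𝒮 : 𝒮 ⊆ Icc 1 S) :
    ‖∑ s ∈ 𝒮, ∑ m ∈ (Icc 1 N).filter (fun m : ℕ => (m : ZMod L) = e),
        ((liouville m : ℤ) : ℂ) * mainKernel R s ((m : ZMod s) * ((c : ZMod s))⁻¹)‖ ≤
      ∑ p ∈ primIndexLe ⌊R⌋₊, ∑ d ∈ Icc 1 S,
        (∑ s ∈ 𝒮.filter (fun s => p.1 ∣ s ∧ d ∣ s), ((Nat.totient s : ℝ))⁻¹) *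
          ‖∑ t ∈ (Icc 1 (N / d)).filter (fun t : ℕ => ((d * t : ℕ) : ZMod L) = e),
              ((liouville t : ℤ) : ℂ) * p.2 (t : ZMod p.1)‖ := by
  refine (norm_sum_le _ _).trans ?_
  have hs1 : ∀ s ∈ 𝒮, 0 < s := fun s hs => (mem_Icc.1 (h𝒮 hs)).1
  refine (sum_le_sum fun s hs => norm_class_liouville_mainKernel_le_one (hs1 s hs) _ e R N).trans ?_
  exact sum_weight_primIndex_divisors_le h𝒮 R (fun s _ => inv_nonneg.2 (Nat.cast_nonneg _))
    (fun _ _ => norm_nonneg _)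

/-! ### The trivial bound for one class -/

/-- Counting one class through a unit multiplier: for `(d, L) = 1`, `L ≠ 0`,
`#{1 ≤ t ≤ M : d t ≡ e (mod L)} ≤ M/L + 1`. [folklore] -/
theorem card_filter_mul_natCast_eq_le {L : ℕ} [NeZero L] {d : ℕ} (hd : d.Coprime L) (e : ZMod L)
    (M : ℕ) : #((Icc 1 M).filter (fun t : ℕ => ((d * t : ℕ) : ZMod L) = e)) ≤ M / L + 1 := by
  have hu : IsUnit (d : ZMod L) := (ZMod.isUnit_iff_coprime d L).2 hd
  have heq : (Icc 1 M).filter (fun t : ℕ => ((d * t : ℕ) : ZMod L) = e) =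
      (Icc 1 M).filter (fun t : ℕ => (t : ZMod L) = e * ((d : ZMod L))⁻¹) := by
    refine filter_congr fun t _ => ?_
    rw [Nat.cast_mul]
    constructor
    · intro h
      rw [← h, mul_comm ((d : ZMod L)) (t : ZMod L), mul_assoc, ZMod.mul_inv_of_unit _ hu, mul_one]
    · intro h
      rw [h, mul_comm, mul_assoc, ZMod.inv_mul_of_unit _ hu, mul_one]
  rw [heq]
  exact FTLiouville.card_filter_natCast_eq_le _ M

/-- The trivial bound `‖∑_{t ≤ M, dt ≡ e (L)} λ(t)ψ(t)‖ ≤ M/L + 1` for `(d, L) = 1`. [folklore] -/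
theorem norm_sum_filter_mul_char_le_card {L : ℕ} (hL : 0 < L) {d : ℕ} (hd : d.Coprime L) (e : ZMod L)
    (M : ℕ) {f : ℕ} (ψ : DirichletCharacter ℂ f) :
    ‖∑ t ∈ (Icc 1 M).filter (fun t : ℕ => ((d * t : ℕ) : ZMod L) = e),
        ((liouville t : ℤ) : ℂ) * ψ (t : ZMod f)‖ ≤ (M / L : ℕ) + 1 := by
  haveI : NeZero L := ⟨hL.ne'⟩
  refine (norm_sum_le _ _).trans ?_
  calc ∑ t ∈ (Icc 1 M).filter (fun t : ℕ => ((d * t : ℕ) : ZMod L) = e), ‖((liouville t : ℤ) : ℂ) * ψ (t : ZMod f)‖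
      ≤ ∑ t ∈ (Icc 1 M).filter (fun t : ℕ => ((d * t : ℕ) : ZMod L) = e), (1 : ℝ) :=
        sum_le_sum fun t _ => norm_liouville_mul_char_le ψ t
    _ = #((Icc 1 M).filter (fun t : ℕ => ((d * t : ℕ) : ZMod L) = e)) := by simp
    _ ≤ (M / L : ℕ) + 1 := by exact_mod_cast card_filter_mul_natCast_eq_le hd e M

end Drappeau2017

end Literature.NumberTheory.Sieve

end
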